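import Summits.ABC.IUTFork.Cor312Statement
import Literature.IUT.LogVolume.HolomorphicHull
import HarnessLib

/-!
# [IUTchIII] Corollary 3.12, statement — the hull frame over REAL packets (residual R3 resolved)

Record-only file (D-0012) of the abc-iut cell (Cor. 3.12 crew, wave 2, seat abc-iut-c312-7; claim W2-B); TAKES NO
SIDE. `Cor312Statement.lean` types the statement of [IUTchIII] Cor. 3.12 (kurims `paper:url-4b091feeb646`
p. 173 l. 41 – p. 174 l. 19) over an abstract `HullFrame` per tensor packet (hull-sets `λ·𝒪`, relative
compactness, existence of the hull: [IUTchIII] Rmk. 3.9.5 (i), p. 127) — residual R3 of `HOME/plan/C312-RESIDUALS.md`.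
This file RESOLVES R3 against the tree's REAL hull:

* `HullFrame.ofLocalFields K` — the frame of a finite direct sum `⊕_j K_j` of nonarchimedean local fields in
  campaign-S's norm presentation (`Literature.IUT.LogVolume.HolomorphicHull`, seat abc-iut-S2): hull-sets :=
  `LogVolume.IsHullSet K` (`λ·𝒪_L`, every `λ_j ≠ 0`), bounded := `Bornology.IsBounded` (= relatively compact,
  `isBounded_iff_isCompact_closure`), admits-a-hull := `LogVolume.IsNondegenerate K` ("contains a relatively
  compact subset whose log-volume is finite": no coordinate vanishes identically); the frame axiom `hull_mem`
  IS S2's THEOREM `isHullSet_holomorphicHull` + `holomorphicHull_eq_sInter` (the smallest `λ·𝒪_L ⊇ U` exists: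
  the sup of the `j`-th norms is attained, `exists_norm_apply_eq_hullRadius`), and `exists_hul` is "a bounded
  set lies in a big polydisc" (PROVED here). `ofLocalFields_hull_eq`: the frame's hull IS S2's
  `LogVolume.holomorphicHull` on bounded nondegenerate sets and on unbounded sets — so the third hull
  formalism noted by the reviewer of p405425 (advisory (a)) is kernel-identified with S2's (and thereby with
  L6-t4's `LogThetaLattice.holomorphicHull` via c312-6's `Cor312Vol.holomorphicHull_eq_logVolume`).
* `HullFrame.comap e F` — hull frames pull back along ANY map `e : X → Y` (preimages of hull-sets; boundedness
  and non-degeneracy read on the image) — PROVED; this is how a `Cor312.Setting` over c312-1's ALGEBRAIC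
  packets `Thm311.LogShells.Packet` (= `MPacketN ℚ`) receives its frame from the comparison map to the
  completed packet `⊕_j K_j` ([IUTchIII] Prop. 3.1 (i) / 3.2 (i); c312-5's `Real.packet1EquivPi`).
[claim: Mochizuki2012, status: disputed] for the quoted definitions; the constructions are bookkeeping.
Deliberately NOT here: log-volumes (`MRData.logvol` is c312-1's slot; Haar: c312-6/S2), the archimedean
factor (S2's file is nonarchimedean; [IUTchIII] Prop. 3.2 (ii) arch. uses Hermitian unit balls), any judgement.
-/

noncomputable section

namespace Summit.ABC.IUTFork.Cor312

namespace HullFrame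

/-! ## 1. Pulling a hull frame back along a map -/

/-- Hull frames pull back along any map `e : X → Y`: hull-sets of `X` := preimages of hull-sets of `Y`;
`U ⊆ X` is bounded / admits a hull iff `e '' U` is / does. [folklore] -/
def comap {X Y : Type} (e : X → Y) (F : HullFrame Y) : HullFrame X where
  Hul := {H | ∃ H' ∈ F.Hul, H = e ⁻¹' H'}
  IsBounded U := F.IsBounded (e '' U)
  HasHull U := F.HasHull (e '' U)
  hul_bounded := by
    rintro _ ⟨H', hH', rfl⟩
    exact F.bounded_mono _ H' (Set.image_preimage_subset e H') (F.hul_bounded H' hH')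
  bounded_mono U U' h hb := F.bounded_mono _ _ (Set.image_mono h) hb
  exists_hul U hb := by
    obtain ⟨H', hH', hsub⟩ := F.exists_hul _ hb
    exact ⟨e ⁻¹' H', ⟨H', hH', rfl⟩, fun x hx => hsub ⟨x, hx, rfl⟩⟩
  hull_mem U hb hh := by
    refine ⟨⋂₀ {H' | H' ∈ F.Hul ∧ e '' U ⊆ H'}, F.hull_mem _ hb hh, ?_⟩
    ext x
    simp only [Set.mem_sInter, Set.mem_setOf_eq, Set.mem_preimage]
    constructor
    · rintro hx H' ⟨hH', hsub⟩
      exact hx (e ⁻¹' H') ⟨⟨H', hH', rfl⟩, fun y hy => hsub ⟨y, hy, rfl⟩⟩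
    · rintro hx H ⟨⟨H', hH', rfl⟩, hUH⟩
      exact hx H' ⟨hH', by rintro _ ⟨y, hy, rfl⟩; exact hUH hy⟩

/-- The hull of the pulled-back frame is the preimage of the hull of the image, for bounded `U` admitting
a hull. [folklore] -/
theorem comap_hull {X Y : Type} (e : X → Y) (F : HullFrame Y) {U : Set X}
    (hb : F.IsBounded (e '' U)) :
    (F.comap e).hull U = e ⁻¹' F.hull (e '' U) := by
  unfold hull
  rw [if_pos (show (F.comap e).IsBounded U from hb), if_pos hb]
  ext x
  simp only [comap, Set.mem_sInter, Set.mem_setOf_eq, Set.mem_preimage]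
  constructor
  · rintro hx H' ⟨hH', hsub⟩
    exact hx (e ⁻¹' H') ⟨⟨H', hH', rfl⟩, fun y hy => hsub ⟨y, hy, rfl⟩⟩
  · rintro hx H ⟨⟨H', hH', rfl⟩, hUH⟩
    exact hx H' ⟨hH', by rintro _ ⟨y, hy, rfl⟩; exact hUH hy⟩

/-! ## 2. The real frame of a finite direct sum of nonarchimedean local fields (campaign S) -/

open Literature.IUT.LogVolume

variable {J : Type} [Fintype J] (K : J → Type) [∀ j, NontriviallyNormedField (K j)]
  [∀ j, IsUltrametricDist (K j)] [∀ j, ProperSpace (K j)]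

omit [∀ j, IsUltrametricDist (K j)] [∀ j, ProperSpace (K j)] in
/-- A bounded subset of `⊕_j K_j` lies in some hull-set `λ·𝒪_L` (a polydisc with nonzero radii: each `K_j`
has elements of arbitrarily large norm). [folklore] -/
theorem exists_isHullSet_superset {U : Set (Π j, K j)} (hU : Bornology.IsBounded U) :
    ∃ H, IsHullSet K H ∧ U ⊆ H := by
  obtain ⟨R, hR⟩ := isBounded_iff_forall_norm_le.mp hU
  choose c hc using fun j => NormedField.exists_lt_norm (K j) (max R 0)
  refine ⟨hullSet K c, ⟨c, fun j => norm_pos_iff.mp (lt_of_le_of_lt (le_max_right R 0) (hc j)), rfl⟩,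
    fun u hu => (mem_polydisc K).mpr fun j => ?_⟩
  exact ((norm_le_pi_norm u j).trans ((hR u hu).trans (le_max_left R 0))).trans (hc j).le

/-- **The REAL hull frame** of `⊕_j K_j` ([IUTchIII] Rmk. 3.9.5 (i), p. 127, in campaign-S's norm
presentation `Literature.IUT.LogVolume.HolomorphicHull`): hull-sets `λ·𝒪_L` (`IsHullSet`), bounded =
relatively compact (`Bornology.IsBounded`), admits a hull = nondegenerate (`IsNondegenerate`); the axiom
`hull_mem` is S2's theorem that the smallest hull-set containing a bounded nondegenerate set EXISTS
(`isHullSet_holomorphicHull`, `holomorphicHull_eq_sInter`). Resolves residual R3 of `Cor312Statement`.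
[claim: Mochizuki2012, status: disputed] -/
def ofLocalFields : HullFrame (Π j, K j) where
  Hul := {H | IsHullSet K H}
  IsBounded := Bornology.IsBounded
  HasHull := IsNondegenerate K
  hul_bounded H h := IsHullSet.isBounded K h
  bounded_mono U U' h hb := hb.subset h
  exists_hul U hb := by
    obtain ⟨H, hH, hUH⟩ := exists_isHullSet_superset K hb
    exact ⟨H, hH, hUH⟩
  hull_mem U hb hnd := by
    have : ⋂₀ {H | H ∈ {H : Set (Π j, K j) | IsHullSet K H} ∧ U ⊆ H} = holomorphicHull K U := by
      rw [holomorphicHull_eq_sInter K hb hnd]; rfl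
    rw [this]
    exact isHullSet_holomorphicHull K hb hnd

/-- On bounded nondegenerate `U` the frame's hull IS S2's `holomorphicHull` (hence, via c312-6's
`Cor312Vol.holomorphicHull_eq_logVolume`, L6-t4's `LogThetaLattice.holomorphicHull`). [folklore] -/
theorem ofLocalFields_hull_eq {U : Set (Π j, K j)} (hb : Bornology.IsBounded U) (hnd : IsNondegenerate K U) :
    (ofLocalFields K).hull U = holomorphicHull K U := by
  unfold hull
  rw [if_pos (show (ofLocalFields K).IsBounded U from hb), holomorphicHull_eq_sInter K hb hnd]
  rfl

/-- On unbounded `U` both hulls are everything ("`𝓘^ℚ((−))`"). [folklore] -/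
theorem ofLocalFields_hull_eq_univ {U : Set (Π j, K j)} (hb : ¬ Bornology.IsBounded U) :
    (ofLocalFields K).hull U = holomorphicHull K U := by
  unfold hull
  rw [if_neg (show ¬ (ofLocalFields K).IsBounded U from hb), holomorphicHull_of_not_isBounded K hb]

/-- The frame's hull-sets are exactly S2's hull sets (by construction). [folklore] -/
theorem mem_ofLocalFields_hul {H : Set (Π j, K j)} : H ∈ (ofLocalFields K).Hul ↔ IsHullSet K H := Iff.rfl

/-- A hull frame on ANY carrier `X` compared to the completed packet `⊕_j K_j` by a map `e` ([IUTchIII]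
Prop. 3.1 (i) / 3.2 (i): the tensor packet "may be regarded as … direct sums of … fields"): the pull-back
of the real frame — the intended value of `Cor312.Setting.frame` over c312-1's algebraic packets.
[claim: Mochizuki2012, status: disputed] -/
def ofComparison {X : Type} (e : X → Π j, K j) : HullFrame X := (ofLocalFields K).comap e

/-- Non-vacuity of the real frame's `HasHull` at a hull-set: every `λ·𝒪_L` is bounded and nondegenerate,
so `HullDefined`-type conditions are met by unions containing a hull-set's worth of points. [folklore] -/
theorem isBounded_and_isNondegenerate_of_isHullSet {H : Set (Π j, K j)} (h : IsHullSet K H) :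
    (ofLocalFields K).IsBounded H ∧ (ofLocalFields K).HasHull H :=
  ⟨IsHullSet.isBounded K h, IsHullSet.isNondegenerate K h⟩

end HullFrame

end Summit.ABC.IUTFork.Cor312

end
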